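import Summits.Ventures.CertifiedArithmetic.LowPrec.SRTwoSum
import HarnessLib

/-!
# 2Sum under SR: when is it an error-free transformation? — tools (file XLIII a)

HONEST FRAMING: certified error envelopes and provably optimal rounding/accumulation schemes for
low-precision formats under stated cost models; every table by two implementations; no hardware or
vendor claims.

Files XXXVII–XXXIX (`SRTwoSum*`) proved that 2Sum executed under saturating stochastic rounding is
EXACTLY UNBIASED (`E[s + t] = a + b`) in every format, and SURELY EXACT (`s + t = a + b` with
probability one) on all 225 pairs of FP4 — but NOT in E3M2 (`P = 81/256` on one pair).  Files
XLIII a/b and XLIV settle WHICH formats make 2Sum-under-SR an error-free transformation: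

  **`P(s + t = a + b) = 1` for all data `a, b`  iff  `maxScaled ≤ 4^(m+1)`**

(the largest finite magnitude is at most `4^p` quanta, `p = m + 1` the precision; among the named
formats exactly E2M1 and E2M3).  This file: the branchwise CRITERION (`twoSumE_exact_of_mem`: if on
every faithful branch `a − a'`, `b − b'` and `a + b − s` are values then `t` is the exact error
surely), the integer-grid tools of the case analysis (faithful roundings beyond the hull are the
clamp; strict error-vs-gap; the gap is `≤ 2^p` quanta below `4^p` quanta; small and even integer
multiples of the quantum are values; odd values are bare significands; the saturation error
`a + b − maxRat` is ALWAYS a value, in every format; a faithful rounding of a non-value whose two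
grid neighbours are values is one of them) and the first consequence: **when `maxScaled ≤ 4^p` the
first rounding error `a + b − s` is a value on every branch** (`err_mem_of_small`).  File XLIII b
(`SRTwoSumExactSmall`) runs the case analysis for `a − a'` and `b − b'`; file XLIV
(`SRTwoSumExactLaw`) proves the converse by an explicit pair and states the law.

Nearest prior art: Boldo–Graillat–Muller [BoldoGraillatMuller2017, Thm 4.1, Lemma 4.2, eq. (5)]
(2Sum with deterministic faithful roundings, no overflow: `t` is NOT the exact error in general,
`|t − (a + b − s)|` small); the format criterion `maxScaled ≤ 4^p`, the saturating model and the
probability-one statement are new.  SR background: [ConnollyHighamMary2021], [CrociEtAl2022].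
-/

namespace Summit.Ventures.CertifiedArithmetic.LowPrec.SR

open Literature.ComputerArithmetic.ConnollyHighamMary2021
open Literature.ComputerArithmetic.FloatingPoint
open Finset

/-! ### Generic facts on faithful roundings -/

section Generic

variable {K : Type*} [Field K] [LinearOrder K] [IsStrictOrderedRing K]

/-- STRICT ERROR: a faithful rounding of a NON-member `c` of the hull misses `c` by strictly less
than the candidate gap. -/
theorem Faithful.abs_err_lt_gap {F : Finset K} {c s : K} (hc : InHull F c) (hcF : c ∉ F)
    (hs : Faithful F c s) : |c - s| < up F c - dn F c := by
  obtain ⟨h1, h2⟩ := hs.dn_le_le_up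
  have h3 : dn F c ≤ c := by simpa only [clamp_eq_self hc] using dn_le_clamp F c
  have h4 : c ≤ up F c := by simpa only [clamp_eq_self hc] using clamp_le_up F c
  have hF : F.Nonempty := ⟨s, hs.mem⟩
  have h3' : dn F c < c := lt_of_le_of_ne h3 fun h => hcF (h ▸ dn_mem hF c)
  have h4' : c < up F c := lt_of_le_of_ne h4 fun h => hcF (h.symm ▸ up_mem hF c)
  rw [abs_lt]; constructor <;> linarith

omit [Field K] [IsStrictOrderedRing K] in
/-- BEYOND THE HULL the faithful rounding is the clamp (upper end): if `c` exceeds the largest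
element `M` of `F` then `s = M`. -/
theorem Faithful.eq_of_max_lt {F : Finset K} {c s M : K} (hs : Faithful F c s) (hM : M ∈ F)
    (hmax : ∀ y ∈ F, y ≤ M) (hc : M < c) : s = M := by
  rcases hs.2 with ⟨-, hbest⟩ | ⟨hcs, -⟩
  · exact le_antisymm (hmax s hs.mem) (hbest M hM hc.le)
  · exact absurd (hcs.trans (hmax s hs.mem)) (not_le.mpr hc)

omit [Field K] [IsStrictOrderedRing K] in
/-- A faithful rounding of a non-member `c` whose grid neighbours `l < c < r` are members with no
member strictly between them and `c` is `l` or `r`. -/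
theorem Faithful.eq_or_eq_of_neighbours {F : Finset K} {c s l r : K} (hs : Faithful F c s)
    (hcF : c ∉ F) (hl : l ∈ F) (hr : r ∈ F) (hlc : l ≤ c) (hcr : c ≤ r)
    (hgapl : ∀ y ∈ F, l < y → y < c → False) (hgapr : ∀ y ∈ F, c < y → y < r → False) :
    s = l ∨ s = r := by
  rcases hs.2 with ⟨hsc, hbest⟩ | ⟨hcs, hbest⟩
  · left
    have h1 : l ≤ s := hbest l hl hlc
    rcases h1.lt_or_eq with h | h
    · exact (hgapl s hs.mem h (lt_of_le_of_ne hsc fun e => hcF (e ▸ hs.mem))).elim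
    · exact h.symm
  · right
    have h1 : s ≤ r := hbest r hr hcr
    rcases h1.lt_or_eq with h | h
    · exact (hgapr s hs.mem (lt_of_le_of_ne hcs fun e => hcF (e.symm ▸ hs.mem)) h).elim
    · exact h

end Generic

/-! ### The criterion and the integer-grid tools of a minifloat format -/

section Formats

open MiniFloat

variable {φ : Format}

/-- **THE CRITERION.** If on every branch `(s, a')` of the first two roundings the three
quantities `a − a'`, `b − b'` (`b' = s − a'`, operation 3 being exact surely, file XXXVII) and
`a + b − s` are values of the format, then 2Sum under SR returns the exact error with probability
one: operations 4, 5, 6 are then exact surely and `t = (a − a') + (b − b') = a + b − s`. -/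
theorem twoSumE_exact_of_mem (a b : MiniFloat φ)
    (h : ∀ s a', Faithful (valueSet φ) (a.toRat + b.toRat) s →
      Faithful (valueSet φ) (s - b.toRat) a' →
        a.toRat - a' ∈ valueSet φ ∧ b.toRat - (s - a') ∈ valueSet φ ∧
          a.toRat + b.toRat - s ∈ valueSet φ) :
    twoSumE (valueSet φ) a.toRat b.toRat
      (fun s t => if s + t = a.toRat + b.toRat then 1 else 0) = 1 := by
  rw [twoSumE_eq]
  refine step_eq_of_faithful (valueSet_nonempty φ) _ fun s hs =>
    step_eq_of_faithful (valueSet_nonempty φ) _ fun a' ha' => ?_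
  obtain ⟨h1, h2, h3⟩ := h s a' hs ha'
  simp only [step_of_mem h1, step_of_mem h2]
  rw [show a.toRat - a' + (b.toRat - (s - a')) = a.toRat + b.toRat - s by ring, step_of_mem h3,
    if_pos (by ring)]

/-- Beyond the hull (above): a faithful rounding of `c > maxRat` is `maxRat`. -/
theorem Faithful.eq_maxRat {c s : ℚ} (hs : Faithful (valueSet φ) c s) (hc : φ.maxRat < c) :
    s = φ.maxRat :=
  hs.eq_of_max_lt (maxRat_mem_valueSet φ)
    (fun _ hy => (le_abs_self _).trans (abs_le_maxRat_of_mem_valueSet hy)) hc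

/-- Beyond the hull (below): a faithful rounding of `c < −maxRat` is `−maxRat`. -/
theorem Faithful.eq_neg_maxRat {c s : ℚ} (hs : Faithful (valueSet φ) c s) (hc : c < -φ.maxRat) :
    s = -φ.maxRat := by
  have h := (hs.neg fun y hy => neg_mem_valueSet hy).eq_maxRat (by linarith)
  linarith

/-- An integer multiple `N · quantum` with `N` representable in magnitude is a value. -/
theorem intMul_mem_valueSet {N : ℤ} (h : φ.Representable N.natAbs) :
    (N : ℚ) * φ.quantum ∈ valueSet φ := by
  obtain ⟨y, hy⟩ := exists_toRat_eq_intCast_mul N h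
  exact mem_valueSet.mpr ⟨y, hy⟩

/-- SMALL MULTIPLES: `|N| ≤ 2^(m+1) = 2^p` (and in range) ⟹ `N · quantum` is a value. -/
theorem intMul_mem_of_natAbs_le_pow {N : ℤ} (hN : N.natAbs ≤ 2 ^ (φ.manBits + 1))
    (hmax : N.natAbs ≤ φ.maxScaled) : (N : ℚ) * φ.quantum ∈ valueSet φ :=
  intMul_mem_valueSet (representable_of_pow_dvd (g := 0) (one_dvd _) (by simpa using hN) hmax)

/-- EVEN MULTIPLES: `N` even, `|N| ≤ 2^(m+2)` (and in range) ⟹ `N · quantum` is a value. -/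
theorem intMul_mem_of_even {N : ℤ} (he : (2 : ℤ) ∣ N) (hN : N.natAbs ≤ 2 ^ (φ.manBits + 2))
    (hmax : N.natAbs ≤ φ.maxScaled) : (N : ℚ) * φ.quantum ∈ valueSet φ := by
  refine intMul_mem_valueSet (representable_of_pow_dvd (g := 1) ?_ (by simpa using hN) hmax)
  have h2 : (2 : ℤ).natAbs ∣ N.natAbs := Int.natAbs_dvd_natAbs.mpr he
  simpa using h2

/-- ODD VALUES ARE BARE SIGNIFICANDS: a value with odd signed magnitude has magnitude `< 2^p`. -/
theorem natAbs_lt_pow_of_odd (x : MiniFloat φ) (ho : Odd x.toInt) :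
    x.toInt.natAbs < 2 ^ (φ.manBits + 1) := by
  rw [natAbs_toInt]
  obtain ⟨-, k, j, hk, hkj⟩ := representable_iff.mp (representable_scaledMag x)
  rcases Nat.eq_zero_or_pos j with hj | hj
  · subst hj; simpa [hkj] using hk
  · exfalso
    have he : Even x.scaledMag := ⟨k * 2 ^ (j - 1), by
      rw [hkj, ← two_mul, show (2 : ℕ) ^ j = 2 * 2 ^ (j - 1) by
        rw [← pow_succ']; congr 1; omega]; ring⟩
    have he' : Even x.toInt := Int.natAbs_even.mp (by rwa [natAbs_toInt])
    exact (Int.not_even_iff_odd.mpr ho) he'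

/-- Magnitude transfer: `|N · quantum| ≤ B · quantum ⟹ |N| ≤ B`. -/
theorem natAbs_le_of_abs_mul_le {N : ℤ} {B : ℕ} (h : |(N : ℚ) * φ.quantum| ≤ (B : ℚ) * φ.quantum) :
    N.natAbs ≤ B := by
  have hq := φ.quantum_pos
  rw [abs_mul, abs_of_pos hq] at h
  have h' : |(N : ℚ)| ≤ B := le_of_mul_le_mul_right h hq
  have h'' : (N.natAbs : ℚ) ≤ B := by rw [Nat.cast_natAbs, Int.cast_abs]; exact h'
  exact_mod_cast h''

/-- Magnitude transfer (strict): `|N · quantum| < B · quantum ⟹ |N| < B`. -/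
theorem natAbs_lt_of_abs_mul_lt {N : ℤ} {B : ℕ} (h : |(N : ℚ) * φ.quantum| < (B : ℚ) * φ.quantum) :
    N.natAbs < B := by
  have hq := φ.quantum_pos
  rw [abs_mul, abs_of_pos hq] at h
  have h' : |(N : ℚ)| < B := lt_of_mul_lt_mul_right h hq.le
  have h'' : (N.natAbs : ℚ) < B := by rw [Nat.cast_natAbs, Int.cast_abs]; exact h'
  exact_mod_cast h''

/-- A value in range as an integer: `|x.toInt| ≤ maxScaled`. -/
theorem natAbs_toInt_le_maxScaled (x : MiniFloat φ) : x.toInt.natAbs ≤ φ.maxScaled := by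
  rw [natAbs_toInt]; exact x.scaledMag_le_maxScaled

/-- In range transfer: `|N · quantum| ≤ maxRat ⟹ |N| ≤ maxScaled`. -/
theorem natAbs_le_maxScaled_of_abs_le {N : ℤ} (h : |(N : ℚ) * φ.quantum| ≤ φ.maxRat) :
    N.natAbs ≤ φ.maxScaled :=
  natAbs_le_of_abs_mul_le (by unfold Format.maxRat at h; exact_mod_cast h)

/-- **THE GAP BELOW `4^p` QUANTA**: if `maxScaled ≤ 4^(m+1)` then every `c` with `|c| < maxRat`
has candidate gap `⌈c⌉ − ⌊c⌋ ≤ 2^(m+1) · quantum` (the spacing of the binade `[2^(2m+1), 4^(m+1))`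
quanta is `2^(m+1)` quanta; the single top value `4^(m+1)` quanta, if present, opens no cell). -/
theorem gap_le_pow_of_small (hM : φ.maxScaled ≤ 4 ^ (φ.manBits + 1)) {c : ℚ}
    (hc : |c| < φ.maxRat) :
    up (valueSet φ) c - dn (valueSet φ) c ≤ 2 ^ (φ.manBits + 1) * φ.quantum := by
  have hq := φ.quantum_pos
  have hhull : InHull (valueSet φ) c := (valueSet_inHull_iff φ c).mpr hc.le
  unfold up dn
  rw [clamp_eq_self hhull, valueSet_gap_eq φ hhull]
  refine (MiniFloat.roundUp_sub_roundDown_le hc.le).trans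
    (mul_le_mul_of_nonneg_right (pow_le_pow_right₀ (by norm_num) ?_) hq.le)
  apply Format.shift_le_of_lt_pow
  have h1 : |c| / φ.quantum < φ.maxScaled := by
    rw [div_lt_iff₀ hq]; exact hc
  have h0 : 0 ≤ |c| / φ.quantum := div_nonneg (abs_nonneg c) hq.le
  have h2 : ⌊|c| / φ.quantum⌋.toNat < φ.maxScaled := by
    have h3 : ⌊|c| / φ.quantum⌋ < φ.maxScaled := Int.floor_lt.mpr (by exact_mod_cast h1)
    have h4 : 0 ≤ ⌊|c| / φ.quantum⌋ := Int.floor_nonneg.mpr h0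
    omega
  calc ⌊|c| / φ.quantum⌋.toNat < φ.maxScaled := h2
    _ ≤ 4 ^ (φ.manBits + 1) := hM
    _ = 2 ^ (φ.manBits + 1 + (φ.manBits + 1)) := by rw [← two_mul, pow_mul]; norm_num

/-- **THE SATURATION ERROR IS ALWAYS A VALUE** (every format, no hypothesis): if `a + b > maxRat`
then `a + b − maxRat ∈ F` — it is a multiple of the ulp of the smaller operand, of magnitude below
that operand. [cite: BoldoMelquiond2017, Lemma 5.2 (the EFT criterion); saturating use new] -/
theorem sat_err_mem (a b : MiniFloat φ) (h : φ.maxRat < a.toRat + b.toRat) :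
    a.toRat + b.toRat - φ.maxRat ∈ valueSet φ := by
  -- both operands are positive
  have hA := abs_le.mp (abs_toRat_le_maxRat a)
  have hB := abs_le.mp (abs_toRat_le_maxRat b)
  have ha0 : 0 < a.toRat := by linarith [hB.2]
  have hb0 : 0 < b.toRat := by linarith [hA.2]
  have hq := φ.quantum_pos
  -- the error as an integer multiple of the quantum
  set T : ℤ := a.toInt + b.toInt - φ.maxScaled with hT
  have herr : a.toRat + b.toRat - φ.maxRat = (T : ℚ) * φ.quantum := by
    rw [hT, toRat_eq_toInt_mul, toRat_eq_toInt_mul]; unfold Format.maxRat; push_cast; ring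
  rw [herr]
  have hTpos : 0 < (T : ℚ) * φ.quantum := by rw [← herr]; linarith
  have hT0 : 0 ≤ T := by
    by_contra hneg; push Not at hneg
    have : (T : ℚ) * φ.quantum < 0 := mul_neg_of_neg_of_pos (by exact_mod_cast hneg) hq
    linarith
  have haI := toInt_eq_scaledMag_of_nonneg ha0.le
  have hbI := toInt_eq_scaledMag_of_nonneg hb0.le
  have hM := Int.natCast_dvd_natCast.mpr (pow_ulpExp_dvd_maxScaled b)
  have hM' := Int.natCast_dvd_natCast.mpr (pow_ulpExp_dvd_maxScaled a)
  -- donor = the smaller operand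
  rcases le_total b.scaledMag a.scaledMag with hba | hab
  · refine intMul_mem_valueSet (representable_natAbs_of_dvd_le b ?_ ?_)
    · exact dvd_sub (dvd_add (pow_ulpExp_dvd_toInt hba) (pow_ulpExp_dvd_toInt le_rfl)) hM
    · -- `T · q = a + b − M ≤ b` since `a ≤ M`
      have h1 : (T : ℚ) * φ.quantum ≤ b.toRat := by rw [← herr]; linarith [hA.2]
      rw [toRat_eq_toInt_mul, hbI] at h1; push_cast at h1
      have h2 : (T : ℚ) ≤ b.scaledMag := le_of_mul_le_mul_right h1 hq
      have h3 : T ≤ b.scaledMag := by exact_mod_cast h2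
      omega
  · refine intMul_mem_valueSet (representable_natAbs_of_dvd_le a ?_ ?_)
    · exact dvd_sub (dvd_add (pow_ulpExp_dvd_toInt le_rfl) (pow_ulpExp_dvd_toInt hab)) hM'
    · have h1 : (T : ℚ) * φ.quantum ≤ a.toRat := by rw [← herr]; linarith [hB.2]
      rw [toRat_eq_toInt_mul, haI] at h1; push_cast at h1
      have h2 : (T : ℚ) ≤ a.scaledMag := le_of_mul_le_mul_right h1 hq
      have h3 : T ≤ a.scaledMag := by exact_mod_cast h2
      omega

/-- `maxRat / 2` is a value unless the format is all-subnormal-like (`maxScaled < 2^(m+1)`, where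
every in-range multiple of the quantum is a value). -/
theorem half_maxRat_mem_or_lt (φ : Format) :
    φ.maxRat / 2 ∈ valueSet φ ∨ φ.maxScaled < 2 ^ (φ.manBits + 1) := by
  have h := half_mem_valueSet_or_lt (top φ)
    (by rw [toRat_top]; exact (abs_nonneg _).trans (abs_toRat_le_maxRat (top φ)))
  rwa [toRat_top, scaledMag_top] at h

/-- BOTTOM REGIME: if `maxScaled < 2^(m+1)` every in-range integer multiple of the quantum is a
value. -/
theorem intMul_mem_of_bottom (hbot : φ.maxScaled < 2 ^ (φ.manBits + 1)) {N : ℤ}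
    (hN : N.natAbs ≤ φ.maxScaled) : (N : ℚ) * φ.quantum ∈ valueSet φ := by
  have h := intCast_mul_mem_valueSet (a := top φ) (by rwa [scaledMag_top]) (N := N)
    (by rwa [scaledMag_top])
  exact h

/-- `0 ∈ F` (also in file `SRRungR3Exact`, not imported here). -/
private theorem zero_mem (φ : Format) : (0 : ℚ) ∈ valueSet φ := by
  have h := toRat_mem_valueSet (MiniFloat.zero φ); rwa [toRat_zero] at h

/-- SMALL MULTIPLES (rational form): `|N · quantum| ≤ 2^p · quantum` with `2^p ≤ maxScaled`
⟹ `N · quantum` is a value. -/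
theorem intMul_mem_of_abs_le_pow (hbig : 2 ^ (φ.manBits + 1) ≤ φ.maxScaled) {N : ℤ}
    (h : |(N : ℚ) * φ.quantum| ≤ (2 ^ (φ.manBits + 1) : ℕ) * φ.quantum) :
    (N : ℚ) * φ.quantum ∈ valueSet φ :=
  intMul_mem_of_natAbs_le_pow (natAbs_le_of_abs_mul_le h)
    ((natAbs_le_of_abs_mul_le h).trans hbig)

/-- No value lies strictly between two consecutive integer multiples of the quantum. -/
theorem not_mem_strictly_between {X : ℤ} {y : ℚ} (hy : y ∈ valueSet φ)
    (h1 : (X : ℚ) * φ.quantum < y) (h2 : y < ((X + 1 : ℤ) : ℚ) * φ.quantum) : False := by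
  obtain ⟨v, rfl⟩ := mem_valueSet.mp hy
  have hq := φ.quantum_pos
  rw [toRat_eq_toInt_mul] at h1 h2
  have h1' : (X : ℚ) < v.toInt := lt_of_mul_lt_mul_right h1 hq.le
  have h2' : (v.toInt : ℚ) < ((X + 1 : ℤ) : ℚ) := lt_of_mul_lt_mul_right h2 hq.le
  have h1'' : X < v.toInt := by exact_mod_cast h1'
  have h2'' : v.toInt < X + 1 := by exact_mod_cast h2'
  omega

/-! ### `a + b − s` is a value -/

/-- **THE FIRST ERROR IS A VALUE** when `maxScaled ≤ 4^(m+1)`: for every faithful (saturating)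
rounding `s` of `a + b`, `a + b − s ∈ F`.  (False in general: E3M2-shaped formats with a wider
exponent range round `a + b` across a binade of spacing `2^(p+1)` quanta.) -/
theorem err_mem_of_small (hM : φ.maxScaled ≤ 4 ^ (φ.manBits + 1)) (a b : MiniFloat φ) {s : ℚ}
    (hs : Faithful (valueSet φ) (a.toRat + b.toRat) s) :
    a.toRat + b.toRat - s ∈ valueSet φ := by
  have hq := φ.quantum_pos
  obtain ⟨w, rfl⟩ := mem_valueSet.mp hs.mem
  have herr : a.toRat + b.toRat - w.toRat
      = ((a.toInt + b.toInt - w.toInt : ℤ) : ℚ) * φ.quantum := by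
    simp only [toRat_eq_toInt_mul]; push_cast; ring
  rcases Nat.lt_or_ge φ.maxScaled (2 ^ (φ.manBits + 1)) with hbot | hbig
  · -- bottom regime: every in-range multiple of the quantum is a value
    rw [herr]
    exact intMul_mem_of_bottom hbot (natAbs_le_maxScaled_of_abs_le
      (herr ▸ (valueSet_inHull_iff φ _).mp (inHull_err_of_faithful a b hs)))
  rcases lt_or_ge φ.maxRat (a.toRat + b.toRat) with hsat | hle
  · rw [hs.eq_maxRat hsat]; exact sat_err_mem a b hsat
  rcases lt_or_ge (a.toRat + b.toRat) (-φ.maxRat) with hsat' | hge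
  · rw [hs.eq_neg_maxRat hsat']
    have h := sat_err_mem a.flipSign b.flipSign
      (by rw [toRat_flipSign, toRat_flipSign]; linarith)
    rw [toRat_flipSign, toRat_flipSign] at h
    have h2 := neg_mem_valueSet h
    convert h2 using 1; ring
  by_cases hcF : a.toRat + b.toRat ∈ valueSet φ
  · rw [hs.eq_of_mem hcF, sub_self]; exact zero_mem φ
  -- inside the hull, not a value: `|err| < gap ≤ 2^p · quantum`
  have hlt : |a.toRat + b.toRat| < φ.maxRat := by
    refine lt_of_le_of_ne (abs_le.mpr ⟨hge, hle⟩) fun h => hcF ?_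
    rcases (abs_eq ((abs_nonneg _).trans_eq h)).mp h with h' | h'
    · rw [h']; exact maxRat_mem_valueSet φ
    · rw [h']; exact neg_maxRat_mem_valueSet φ
  have hgap := hs.abs_err_lt_gap ((valueSet_inHull_iff φ _).mpr hlt.le) hcF
  have h1 := gap_le_pow_of_small hM hlt
  have hP : ((2 ^ (φ.manBits + 1) : ℕ) : ℚ) = 2 ^ (φ.manBits + 1) := by push_cast; ring
  rw [herr] at hgap ⊢
  exact intMul_mem_of_abs_le_pow hbig (by rw [hP]; linarith)

end Formats

end Summit.Ventures.CertifiedArithmetic.LowPrec.SR
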